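import Literature.NumberTheory.Sieve.HeathBrownCubicNormSublevel
import HarnessLib

/-!
# The integral of `m(𝐱) = w(N(𝐱)+ΔV) − w(N(𝐱))` over the cube ((9.17)–(9.19))

Part of the reduction *Lemma 9.2 ⇐ Lemma 9.4* in §9 of D. R. Heath-Brown, *Primes represented by `x³ + 2y³`*,
Acta Math. 186 (2001) (this seat's route to the named fact `HeathBrown2001_lemma_3_8`). In (9.16)–(9.20) the
integral `𝓙 = ∫_𝒞 E'(𝐱)` is evaluated through Lemma 9.3, whose main term carries
`m(𝐱) = w(N(𝐱)+ΔV) − w(N(𝐱))`; p. 58 then computes `∫_𝒞 m(𝐱) dx dy dz`. This file PROVES, for the tree's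
`wMeas`/`wDeriv`/`cubeIntegral` and a cube `𝒞 = realCube a S₀` with `CubeCond c₃ c₄ V a S₀`:

* `wMeas_window_bounds` — `0 ≤ m ≤ ΔV(ξ log X)^n` ((8.4)); `integrableOn_wMeas_window`;
* `abs_integral_window_sub_le` — **(9.18), `n ≥ 1`** (length `n + 2`):
  `|∫_𝒞 m − ΔV·𝓘| ≤ (2Δ²V/c₄)(ξ log X)^n S₀³`, from the mean value form of (8.3)
  (`abs_wMeas_sub_sub_mul_wDeriv_le`) and `N ≥ c₄V` on `𝒞`;
* `abs_integral_window_sub_le_of_one` — **(9.19), `n = 0`** (length `1`):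
  `|∫_𝒞 m − ΔV·𝓘| ≤ ΔV · 2 · 18ΔV S₀² c₃V^{1/3}/(c₄V)`: `m(𝐱) = ΔV w'(N(𝐱))` unless an endpoint of `J(m₁)` lies in
  `(N(𝐱), N(𝐱)+ΔV]` (`wMeas_sub_wMeas_eq_mul_wDeriv_of_one`), `0 ≤ m, ΔVw' ≤ ΔV`, and the exceptional `𝐱` form a
  set of measure `≤ 2·vol{𝐱 ∈ 𝒞 : |N(𝐱) − A| ≤ ΔV}` (`volume_normForm_near_le` of `HeathBrownCubicNormSublevel`).

## References

* D. R. Heath-Brown, *Primes represented by `x³ + 2y³`*, Acta Math. 186 (2001), §9 p. 58, (9.17)–(9.19).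
  [cite: HeathBrownActa2001, §9 (9.19)]

## Mathlib / tree search

Tree: `abs_wMeas_sub_sub_mul_wDeriv_le`, `wMeas_sub_wMeas_eq_mul_wDeriv_of_one`, `wMeas_sub_wMeas_eq_integral`, `wDeriv_le`,
`wDeriv_nonneg`, `continuous_wMeas`, `intervalIntegrable_wDeriv` (`HeathBrownCubicWCalculus`), `volume_normForm_near_le`
(`HeathBrownCubicNormSublevel`), `volume_realCube`, `measurableSet_realCube`, `continuous_normForm`, `integrableOn_wDeriv_normForm`
(`HeathBrownCubicCubeSums`), `cubeIntegral` (`HeathBrownCubicSiegelWalfisz`). Mathlib: `norm_setIntegral_le_of_norm_le_const`,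
`norm_integral_le_of_norm_le`, `integral_indicator`, `Measure.restrict_restrict`, `setIntegral_const`.
-/

noncomputable section

open MeasureTheory Set Filter

namespace Literature.NumberTheory.Sieve.CubicSieve

variable {X τ : ℝ}

/-- `0 ≤ w(t+h) − w(t) ≤ h(ξ log X)^n` for `h ≥ 0` ((8.4): `0 ≤ w' ≤ (ξ log X)^n`). [cite: HeathBrownActa2001, §8 (8.4)] -/
theorem wMeas_window_bounds (hX : 1 ≤ X) (hτ : 0 ≤ τ) {n : ℕ} (m : Fin (n + 1) → ℕ) {t h : ℝ} (hh : 0 ≤ h) :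
    0 ≤ wMeas X τ m (t + h) - wMeas X τ m t ∧ wMeas X τ m (t + h) - wMeas X τ m t ≤ h * (hbXi τ * Real.log X) ^ n := by
  have hX0 : 0 < X := by linarith
  rw [wMeas_sub_wMeas_eq_integral hX hτ m (by linarith : t ≤ t + h)]
  constructor
  · exact intervalIntegral.integral_nonneg (by linarith) fun u _ => wDeriv_nonneg hX0 m u
  · have := intervalIntegral.integral_mono_on (by linarith : t ≤ t + h) (intervalIntegrable_wDeriv hX hτ m t (t + h))
      intervalIntegrable_const (fun u _ => wDeriv_le hX hτ m u)
    rw [intervalIntegral.integral_const, smul_eq_mul] at this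
    convert this using 1; ring

/-- **`m(𝐱) = w(N(𝐱)+ΔV) − w(N(𝐱))` is integrable on the cube** (continuous and bounded). [folklore] -/
theorem integrableOn_wMeas_window (hX : 1 ≤ X) (hτ : 0 ≤ τ) {n : ℕ} (m : Fin (n + 1) → ℕ) {Δ V : ℝ}
    (hΔV : 0 ≤ Δ * V) (a : ℝ × ℝ × ℝ) {S₀ : ℝ} (hS₀ : 0 ≤ S₀) :
    IntegrableOn (fun p => wMeas X τ m (normForm p + Δ * V) - wMeas X τ m (normForm p)) (realCube a S₀) := by
  have hX0 : 0 < X := by linarith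
  haveI : IsFiniteMeasure ((volume : Measure (ℝ × ℝ × ℝ)).restrict (realCube a S₀)) :=
    ⟨by rw [Measure.restrict_apply_univ, volume_realCube a hS₀]; exact ENNReal.ofReal_lt_top⟩
  have hcont : Continuous fun p : ℝ × ℝ × ℝ => wMeas X τ m (normForm p + Δ * V) - wMeas X τ m (normForm p) :=
    ((continuous_wMeas hX0 m).comp (continuous_normForm.add continuous_const)).sub
      ((continuous_wMeas hX0 m).comp continuous_normForm)
  refine Integrable.mono' (integrable_const (Δ * V * (hbXi τ * Real.log X) ^ n)) hcont.measurable.aestronglyMeasurable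
    (Eventually.of_forall fun p => ?_)
  obtain ⟨h0, h1⟩ := wMeas_window_bounds hX hτ m (t := normForm p) hΔV
  rw [Real.norm_eq_abs, abs_of_nonneg h0]; exact h1

/-- **(9.17)–(9.18), `n ≥ 1`**: "When `n ≥ 1` we may estimate `m(𝐱)` via the Mean Value Theorem, in conjunction
with (8.3). Thus … `m(𝐱) = ΔV w'(N(𝐱)) + O(Δ²V(ξ log X)^{n−1})`. In this case the integral in (9.17) is
`ΔV ∫_𝒞 w'(N(𝐱)) + O(Δ²VS₀³(ξ log X)^{n−1}) = ΔV𝓘 + O(Δ²VS₀³(ξ log X)^{n−1})`" (p. 58). Here for `𝐦` of length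
`n + 2` (the paper's `n + 1 ≥ 2`), with `N ≥ c₄V` on the cube and the explicit constant `2/c₄`
(`abs_wMeas_sub_sub_mul_wDeriv_le`). [cite: HeathBrownActa2001, §9 (9.18)] -/
theorem abs_integral_window_sub_le (hX : 1 ≤ X) (hτ : 0 ≤ τ) {n : ℕ} (m : Fin (n + 2) → ℕ)
    {c₃ c₄ V Δ : ℝ} (hc₄ : 0 < c₄) (hV : 0 < V) (hΔ : 0 ≤ Δ) {a : ℝ × ℝ × ℝ} {S₀ : ℝ} (hS₀ : 0 ≤ S₀)
    (hcube : CubeCond c₃ c₄ V a S₀) :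
    |(∫ p in realCube a S₀, (wMeas X τ m (normForm p + Δ * V) - wMeas X τ m (normForm p))) -
        Δ * V * cubeIntegral X τ m a S₀| ≤
      2 * Δ ^ 2 * V / c₄ * (hbXi τ * Real.log X) ^ n * S₀ ^ 3 := by
  have hΔV : 0 ≤ Δ * V := by positivity
  have hint₁ := integrableOn_wMeas_window hX hτ m hΔV a hS₀
  have hint₂ := integrableOn_wDeriv_normForm hX hτ m a hS₀
  rw [cubeIntegral, ← integral_const_mul, ← integral_sub hint₁ (hint₂.const_mul _)]
  have hbound : ∀ p ∈ realCube a S₀,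
      ‖(wMeas X τ m (normForm p + Δ * V) - wMeas X τ m (normForm p)) - Δ * V * wDeriv X τ m (normForm p)‖ ≤
        2 * Δ ^ 2 * V / c₄ * (hbXi τ * Real.log X) ^ n := by
    intro p hp
    have hN : c₄ * V ≤ normForm p := by have := (hcube p hp).2.2.2; rw [normForm]; exact this
    have hN0 : 0 < normForm p := lt_of_lt_of_le (by positivity) hN
    have h := abs_wMeas_sub_sub_mul_wDeriv_le hX hτ m hN0 (by linarith : normForm p ≤ normForm p + Δ * V)
    rw [show normForm p + Δ * V - normForm p = Δ * V by ring] at h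
    rw [Real.norm_eq_abs]
    refine h.trans ?_
    have hξ : 0 ≤ (hbXi τ * Real.log X) ^ n := by
      apply pow_nonneg; exact mul_nonneg (by rw [hbXi]; exact pow_nonneg hτ 5) (Real.log_nonneg hX)
    have hq : (Δ * V) ^ 2 / normForm p ≤ Δ ^ 2 * V / c₄ := by
      rw [div_le_div_iff₀ hN0 hc₄]; nlinarith [sq_nonneg Δ]
    calc 2 * ((Δ * V) ^ 2 / normForm p) * (hbXi τ * Real.log X) ^ n = 2 * ((Δ * V) ^ 2 / normForm p * (hbXi τ * Real.log X) ^ n) := by ring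
      _ ≤ 2 * (Δ ^ 2 * V / c₄ * (hbXi τ * Real.log X) ^ n) := by
          exact mul_le_mul_of_nonneg_left (mul_le_mul_of_nonneg_right hq hξ) (by norm_num)
      _ = 2 * Δ ^ 2 * V / c₄ * (hbXi τ * Real.log X) ^ n := by ring
  calc |∫ p in realCube a S₀, (wMeas X τ m (normForm p + Δ * V) - wMeas X τ m (normForm p)) - Δ * V * wDeriv X τ m (normForm p)|
      ≤ 2 * Δ ^ 2 * V / c₄ * (hbXi τ * Real.log X) ^ n * (volume (realCube a S₀)).toReal := by
        rw [← Real.norm_eq_abs]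
        exact norm_setIntegral_le_of_norm_le_const (by rw [volume_realCube a hS₀]; exact ENNReal.ofReal_lt_top) hbound
    _ = 2 * Δ ^ 2 * V / c₄ * (hbXi τ * Real.log X) ^ n * S₀ ^ 3 := by
        rw [volume_realCube a hS₀, ENNReal.toReal_ofReal (by positivity)]

/-- **(9.19), `n = 0`**: "When `n = 0` we observe that `0 ≤ m(𝐱) ≤ ΔV` for all `𝐱`, and that if
`J(m₁) = [a, b)`, say, then `m(𝐱) = ΔV` (`a < N(𝐱) < b − ΔV`), `0` (`N(𝐱) < a − ΔV` or `N(𝐱) > b`). When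
`𝐱` is confined to the cube `𝒞`, the set for which `|N(𝐱) − a| ≤ ΔV` has measure `O(ΔV)`, and similarly for
`|N(𝐱) − b| ≤ ΔV`. Since `w'(t)` is the characteristic function of `J(m₁)` … it follows that
`∫_𝒞 m(𝐱) = ΔV ∫_𝒞 w'(N(𝐱)) + O(Δ²V²)`" (p. 58). Here with the measure bound
`volume_normForm_near_le` (`≤ 18ΔV S₀²c₃V^{1/3}/(c₄V)` per endpoint). [cite: HeathBrownActa2001, §9 (9.19)] -/
theorem abs_integral_window_sub_le_of_one (hX : 1 ≤ X) (hτ : 0 ≤ τ) (m : Fin 1 → ℕ)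
    {c₃ c₄ V Δ : ℝ} (hc₃ : 0 < c₃) (hc₄ : 0 < c₄) (hV : 0 < V) (hΔ : 0 ≤ Δ) {a : ℝ × ℝ × ℝ} {S₀ : ℝ} (hS₀ : 0 ≤ S₀)
    (hcube : CubeCond c₃ c₄ V a S₀) :
    |(∫ p in realCube a S₀, (wMeas X τ m (normForm p + Δ * V) - wMeas X τ m (normForm p))) -
        Δ * V * cubeIntegral X τ m a S₀| ≤
      Δ * V * (2 * (18 * (Δ * V) * S₀ ^ 2 * (c₃ * V ^ (1 / 3 : ℝ)) / (c₄ * V))) := by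
  have hX0 : 0 < X := by linarith
  have hΔV : 0 ≤ Δ * V := by positivity
  have hint₁ := integrableOn_wMeas_window hX hτ m hΔV a hS₀
  have hint₂ := integrableOn_wDeriv_normForm hX hτ m a hS₀
  set lo : ℝ := X ^ ((m 0 : ℝ) * hbXi τ) with hlo
  set hi : ℝ := X ^ (((m 0 : ℝ) + 1) * hbXi τ) with hhi
  -- the exceptional set
  set Exc : Set (ℝ × ℝ × ℝ) := {p | p ∈ realCube a S₀ ∧ |normForm p - lo| ≤ Δ * V} ∪ {p | p ∈ realCube a S₀ ∧ |normForm p - hi| ≤ Δ * V}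
    with hExc
  have hExcm : MeasurableSet Exc := by
    rw [hExc]
    refine MeasurableSet.union ?_ ?_ <;>
      exact (measurableSet_realCube a S₀).inter
        (measurableSet_le (continuous_abs.comp (continuous_normForm.sub continuous_const)).measurable measurable_const)
  have hvol : volume Exc ≤ ENNReal.ofReal (2 * (18 * (Δ * V) * S₀ ^ 2 * (c₃ * V ^ (1 / 3 : ℝ)) / (c₄ * V))) := by
    rw [hExc]
    refine (measure_union_le _ _).trans ?_
    rw [two_mul, ENNReal.ofReal_add (by positivity) (by positivity)]
    exact add_le_add (volume_normForm_near_le hc₃ hc₄ hV hS₀ hcube lo hΔV) (volume_normForm_near_le hc₃ hc₄ hV hS₀ hcube hi hΔV)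
  rw [cubeIntegral, ← integral_const_mul, ← integral_sub hint₁ (hint₂.const_mul _)]
  -- pointwise: the difference vanishes off `Exc` and is `≤ ΔV` on it
  have hpt : ∀ p ∈ realCube a S₀,
      ‖(wMeas X τ m (normForm p + Δ * V) - wMeas X τ m (normForm p)) - Δ * V * wDeriv X τ m (normForm p)‖ ≤
        Exc.indicator (fun _ => Δ * V) p := by
    intro p hp
    by_cases hE : p ∈ Exc
    · rw [Set.indicator_of_mem hE, Real.norm_eq_abs]
      obtain ⟨h0, h1⟩ := wMeas_window_bounds hX hτ m (t := normForm p) hΔV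
      simp only [pow_zero, mul_one] at h1
      have hw0 := wDeriv_nonneg (τ := τ) hX0 m (normForm p)
      have hw1 : wDeriv X τ m (normForm p) ≤ 1 := by
        have := wDeriv_le hX hτ m (normForm p); simpa using this
      rw [abs_le]; constructor <;> nlinarith
    · rw [Set.indicator_of_notMem hE]
      have hlo' : lo ∉ Set.Ioc (normForm p) (normForm p + Δ * V) := by
        intro h; apply hE; rw [hExc]; left
        obtain ⟨h1, h2⟩ := h
        exact ⟨hp, abs_le.mpr ⟨by linarith, by linarith⟩⟩
      have hhi' : hi ∉ Set.Ioc (normForm p) (normForm p + Δ * V) := by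
        intro h; apply hE; rw [hExc]; right
        obtain ⟨h1, h2⟩ := h
        exact ⟨hp, abs_le.mpr ⟨by linarith, by linarith⟩⟩
      rw [wMeas_sub_wMeas_eq_mul_wDeriv_of_one hX hτ m (by linarith) hlo' hhi',
        show normForm p + Δ * V - normForm p = Δ * V by ring, sub_self, norm_zero]
  haveI : IsFiniteMeasure ((volume : Measure (ℝ × ℝ × ℝ)).restrict (realCube a S₀)) :=
    ⟨by rw [Measure.restrict_apply_univ, volume_realCube a hS₀]; exact ENNReal.ofReal_lt_top⟩
  have hint₃ : Integrable (Exc.indicator fun _ => Δ * V) ((volume : Measure (ℝ × ℝ × ℝ)).restrict (realCube a S₀)) :=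
    (integrable_const (Δ * V)).indicator hExcm
  have hae : ∀ᵐ p ∂((volume : Measure (ℝ × ℝ × ℝ)).restrict (realCube a S₀)),
      ‖(wMeas X τ m (normForm p + Δ * V) - wMeas X τ m (normForm p)) - Δ * V * wDeriv X τ m (normForm p)‖ ≤
        Exc.indicator (fun _ => Δ * V) p :=
    (ae_restrict_iff' (measurableSet_realCube a S₀)).mpr (Eventually.of_forall hpt)
  calc |∫ p in realCube a S₀, (wMeas X τ m (normForm p + Δ * V) - wMeas X τ m (normForm p)) - Δ * V * wDeriv X τ m (normForm p)|
      ≤ ∫ p in realCube a S₀, Exc.indicator (fun _ => Δ * V) p := by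
        rw [← Real.norm_eq_abs]; exact norm_integral_le_of_norm_le hint₃ hae
    _ = (volume (Exc ∩ realCube a S₀)).toReal * (Δ * V) := by
        rw [integral_indicator hExcm, Measure.restrict_restrict hExcm, setIntegral_const, smul_eq_mul, measureReal_def]
    _ ≤ (2 * (18 * (Δ * V) * S₀ ^ 2 * (c₃ * V ^ (1 / 3 : ℝ)) / (c₄ * V))) * (Δ * V) := by
        apply mul_le_mul_of_nonneg_right _ hΔV
        have h1 : volume (Exc ∩ realCube a S₀) ≤ ENNReal.ofReal (2 * (18 * (Δ * V) * S₀ ^ 2 * (c₃ * V ^ (1 / 3 : ℝ)) / (c₄ * V))) :=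
          (measure_mono Set.inter_subset_left).trans hvol
        exact ENNReal.toReal_le_of_le_ofReal (by positivity) h1
    _ = Δ * V * (2 * (18 * (Δ * V) * S₀ ^ 2 * (c₃ * V ^ (1 / 3 : ℝ)) / (c₄ * V))) := by ring

end Literature.NumberTheory.Sieve.CubicSieve
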